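import Summits.NavierStokesRegularity.NavierStokesRegularity.Theses.AxisymmetricExtremality
import Summits.NavierStokesRegularity.NavierStokesRegularity.Theorems.AxisymmetricExtremalityAxisymmetricKatoGlobalReduction
import Literature.Analysis.FluidPDE.RusinSverakSingularPoint
import Literature.Analysis.FluidPDE.AxisymmetricTypeIBounded
import Literature.Analysis.FluidPDE.SereginSverakAxisymmetric
import Literature.Analysis.FluidPDE.Seregin2022LogSwirlCriterion
import HarnessLib

/-!
# Strategist s12-g12 (independent census family `s`) — typed attempts for the crux
# `AxisymmetricExtremality.AxisymmetricKatoGlobal` (stmt-NavierStokesRegularity-15453)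

Scratch file of the strategy census `STRATEGY-CENSUS-s12-g12.md`.  Nothing here is a line or a
stub; every theorem is sorry-free bookkeeping that makes a census claim kernel-checked:

* §1 WEAKER INTERMEDIATE from the summit statement: `NoAxisymMinimalBlowup` (W1: no axisymmetric
  datum lies in Rusin–Šverák's minimal blow-up set `M(ν)`) replaces the crux in `closes`
  (`closes_of_noAxisymMinimalBlowup`) and is implied by the crux (`noAxisymMinimalBlowup_of_crux`).
* §2 DECOMPOSITION Σ1 (rate dichotomy at an axis point): `RateFreeSwirlCriterion` (A) and
  `PersistentSwirlBounded` (B), the proved seam `axisBounded_of_A_B`, and the kernel-checked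
  assembly `AxisymmetricKatoGlobal_of_axisBounded` from on-axis boundedness plus the LANDED stubs
  1, K, 2b' of the registered line — so `A → B → crux` is a theorem (`AxisymmetricKatoGlobal_of_A_B`).
* §3 STRENGTHEN: `LocalAxisRegularity` (S⁺ = Seregin's local axis-regularity problem, the named
  fact `seregin2022_logSwirl_regularAtOrigin` with its swirl-modulus hypothesis deleted) and the
  trivial weakening `seregin2022_of_localAxisRegularity`.
-/

noncomputable section

set_option linter.dupNamespace false
set_option linter.unusedVariables false

open Set MeasureTheory Filter Topology Function Metric
open scoped ENNReal NNReal
open Literature.Analysis.FluidPDE Literature.Analysis.FunctionSpaces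

namespace Summit.NavierStokesRegularity.NavierStokesRegularity.Cruxes.AxisymmetricKatoGlobal.StrategistS12g12

open Summit.NavierStokesRegularity.NavierStokesRegularity.Theses.AxisymmetricExtremality

local notation "ℝ³" => EuclideanSpace ℝ (Fin 3)

/-! ## §1 Weaker intermediate (from the summit statement) -/

/-- **W1.** No axisymmetric datum is a Rusin–Šverák minimal blow-up datum: for every `ν > 0`, no
`u₀ ∈ L³`, weakly divergence free, represented by `g ∈ Ḣ^{1/2}` with `‖g‖ = ρ_max^pure(ν)` and
without a global Kato solution, is axisymmetric.  Equivalently: the crux restricted to data of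
critical norm exactly `ρ_max(ν)`. -/
def NoAxisymMinimalBlowup : Prop :=
  ∀ ν : ℝ, 0 < ν → ∀ (u₀ : ℝ³ → ℝ³) (g : HomSobolev ℝ³ (EuclideanSpace ℂ (Fin 3)) (1 / 2 : ℝ)),
    IsMinimalBlowupDatum ν u₀ g → IsAxisymmetric u₀ → False

/-- The crux implies W1 (W1 is the crux on the sphere `‖g‖ = ρ_max`). -/
theorem noAxisymMinimalBlowup_of_crux (h : AxisymmetricKatoGlobal) : NoAxisymMinimalBlowup := by
  intro ν hν u₀ g hmin hax
  obtain ⟨hL3, hrep, hdiv, -, hnot⟩ := hmin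
  exact hnot (h ν hν u₀ g hL3 hrep hdiv (fun θ x => hax θ x))

/-- W1 suffices in place of the crux in the route's deciding theorem (same pure-logic proof as
`closes`): `MinimalDatumPFold → PFoldToAxisymmetric → W1 → NavierStokesRegularity`. -/
theorem closes_of_noAxisymMinimalBlowup (h₂ : MinimalDatumPFold) (h₄ : PFoldToAxisymmetric)
    (hW : NoAxisymMinimalBlowup) : NavierStokesRegularity := by
  show Literature.NS.NavierStokesExistenceSmoothR3
  intro ν hν u₀ hsm hdiv hdec
  by_contra hno
  obtain ⟨u₁, g, hmin, hax⟩ := h₄ ν hν (h₂ ν hν ⟨u₀, hsm, hdiv, hdec, hno⟩)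
  exact hW ν hν u₁ g hmin (fun θ x => hax θ x)

/-! ## §2 Decomposition Σ1 — rate dichotomy of the swirl at an axis point -/

/-- "The swirl tends to zero at the space-time point `(T, x₀)`": for every `ε > 0` there is
`δ > 0` with `|Γ(t,x)| ≤ ε` for `T - δ² < t < T`, `0 < t`, `|x - x₀| < δ`. -/
def SwirlVanishesAt (u : ℝ → ℝ³ → ℝ³) (T : ℝ) (x₀ : ℝ³) : Prop :=
  ∀ ε : ℝ, 0 < ε → ∃ δ : ℝ, 0 < δ ∧ ∀ t ∈ Ioo (T - δ ^ 2) T, 0 < t →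
    ∀ x ∈ ball x₀ δ, |swirl (u t) x| ≤ ε

/-- **Piece A — rate-free swirl criterion (OPEN; the printed criteria need a RATE:
`|ln r|⁻²` Lei–Zhang 2017, `|ln r|^{-3/2}` Wei 2016, `ln⁻³` local Seregin 2022).**  An axisymmetric
Kato solution on `[0,T)`, smooth inside, whose swirl tends to zero at an axis point `(T, x₀)`
WITHOUT RATE, is bounded near `(T, x₀)`. -/
def RateFreeSwirlCriterion : Prop :=
  ∀ ν : ℝ, 0 < ν → ∀ T : ℝ, 0 < T → ∀ (u₀ : ℝ³ → ℝ³) (u : ℝ → ℝ³ → ℝ³),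
    IsKatoSolutionOn T ν u₀ u → ContDiffOn ℝ (⊤ : ℕ∞) (uncurry u) (Ioo 0 T ×ˢ univ) →
    (∀ t ∈ Ioo 0 T, IsAxisymmetric (u t)) →
    ∀ x₀ : ℝ³, cylRadius x₀ = 0 → SwirlVanishesAt u T x₀ → IsBoundedNearTop u T x₀

/-- **Piece B — persistent swirl is regular (OPEN; carries every expected blow-up scenario:
Hou's tornado keeps `Γ = O(1)` on the collapsing scale).**  An axisymmetric Kato solution on
`[0,T)`, smooth inside, whose swirl does NOT tend to zero at the axis point `(T, x₀)`, is bounded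
near `(T, x₀)`. -/
def PersistentSwirlBounded : Prop :=
  ∀ ν : ℝ, 0 < ν → ∀ T : ℝ, 0 < T → ∀ (u₀ : ℝ³ → ℝ³) (u : ℝ → ℝ³ → ℝ³),
    IsKatoSolutionOn T ν u₀ u → ContDiffOn ℝ (⊤ : ℕ∞) (uncurry u) (Ioo 0 T ×ˢ univ) →
    (∀ t ∈ Ioo 0 T, IsAxisymmetric (u t)) →
    ∀ x₀ : ℝ³, cylRadius x₀ = 0 → ¬ SwirlVanishesAt u T x₀ → IsBoundedNearTop u T x₀

/-- On-axis boundedness near the final time of axisymmetric Kato solutions (the target of Σ1). -/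
def AxisBoundedNearTop : Prop :=
  ∀ ν : ℝ, 0 < ν → ∀ T : ℝ, 0 < T → ∀ (u₀ : ℝ³ → ℝ³) (u : ℝ → ℝ³ → ℝ³),
    IsKatoSolutionOn T ν u₀ u → ContDiffOn ℝ (⊤ : ℕ∞) (uncurry u) (Ioo 0 T ×ˢ univ) →
    (∀ t ∈ Ioo 0 T, IsAxisymmetric (u t)) →
    ∀ x₀ : ℝ³, cylRadius x₀ = 0 → IsBoundedNearTop u T x₀

/-- The seam of Σ1 (trivial: excluded middle on `SwirlVanishesAt`). -/
theorem axisBounded_of_A_B (hA : RateFreeSwirlCriterion) (hB : PersistentSwirlBounded) :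
    AxisBoundedNearTop := by
  intro ν hν T hT u₀ u hK hsm hax x₀ h0
  by_cases hv : SwirlVanishesAt u T x₀
  · exact hA ν hν T hT u₀ u hK hsm hax x₀ h0 hv
  · exact hB ν hν T hT u₀ u hK hsm hax x₀ h0 hv

/-- **Assembly of Σ1 to the crux BY NAME**, from on-axis boundedness and the LANDED stubs of the
registered line: singular point (stub 1, p149337), local energy classes up to the final time
(stub K, p149176), off-axis boundedness (stub 2b', p147674). -/
theorem AxisymmetricKatoGlobal_of_axisBounded (hAx : AxisBoundedNearTop) :
    AxisymmetricKatoGlobal := by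
  intro ν hν u₀ g hL3 hrep hdiv hax
  have hax' : IsAxisymmetric u₀ := fun θ x => hax θ x
  by_contra hng
  obtain ⟨T, hT, xs, u, hK, hsm, haxi, hsing⟩ :=
    Theorems.AxisymmetricKatoGlobal.Registered.stub_katoAxisymSingularPoint ν hν u₀ hL3 hdiv hax' hng
  have hbd : IsBoundedNearTop u T xs := by
    by_cases h0 : cylRadius xs = 0
    · exact hAx ν hν T hT u₀ u hK hsm haxi xs h0
    · obtain ⟨p, hpax, hsw, hloc⟩ :=
        Theorems.AxisymmetricKatoGlobal.Registered.stub_katoLocalEnergyNearTop ν hν T hT u₀ u hK hsm haxi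
      exact Theorems.AxisymmetricKatoGlobal.Registered.stub_offAxisBounded_of_localEnergy
        ν hν T hT u p hsm haxi hsw hloc xs h0
  obtain ⟨r, hr, K, hK'⟩ := hbd
  exact absurd (hsing r hr)
    (Theorems.AxisymmetricKatoGlobal.Registered.eLpNorm_parabolicCylinder_lt_top_of_forall_le hK').ne

/-- Σ1 assembled: `A → B → crux` (kernel-checked; both pieces OPEN). -/
theorem AxisymmetricKatoGlobal_of_A_B (hA : RateFreeSwirlCriterion) (hB : PersistentSwirlBounded) :
    AxisymmetricKatoGlobal :=
  AxisymmetricKatoGlobal_of_axisBounded (axisBounded_of_A_B hA hB)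

/-! ## §3 Strengthen — Seregin's local axis-regularity problem -/

/-- **S⁺ = local axis regularity (Seregin's open problem).**  Verbatim the tree's named fact
`seregin2022_logSwirl_regularAtOrigin` with the swirl-modulus hypothesis (2.2) DELETED: every
axially symmetric suitable weak solution in the unit cylinder `Q = 𝒞 × ]-1,0[` with the printed
global classes has the origin as a regular point. -/
def LocalAxisRegularity : Prop :=
  ∀ (v : ℝ → ℝ³ → ℝ³) (q : ℝ → ℝ³ → ℝ),
    IsSuitableWeakSolutionOn (SereginSverak2009.parCylOpens 0 1) 1 0 v q →
    (∃ C : ℝ≥0, ∀ᵐ t ∂(volume.restrict (Ioo (-1 : ℝ) 0)),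
        ∫⁻ x in SereginSverak2009.spaceCyl 0 1, ‖v t x‖ₑ ^ 2 ≤ C) →
    (∃ G : ℝ → ℝ³ → ℝ³ →L[ℝ] ℝ³,
        HasWeakSpatialGradientOn (SereginSverak2009.parCylOpens 0 1) v G ∧
        ∫⁻ z in SereginSverak2009.parCyl 0 1, ENNReal.ofReal (frobeniusNormSq (G z.1 z.2)) < ∞) →
    (∫⁻ z in SereginSverak2009.parCyl 0 1, ‖q z.1 z.2‖ₑ ^ (3 / 2 : ℝ) < ∞) →
    (∀ t ∈ Ioo (-1 : ℝ) 0, IsAxisymmetric (v t)) →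
    (∀ t ∈ Ioo (-1 : ℝ) 0, IsAxisymmetricScalar (q t)) →
    SereginSverak2009.IsRegularAtOrigin v

/-- S⁺ trivially contains Seregin's 2022 criterion (drop the modulus hypothesis). -/
theorem seregin2022_of_localAxisRegularity (h : LocalAxisRegularity) :
    seregin2022_logSwirl_regularAtOrigin := by
  intro v q hsw hE hG hq hax haxq _hmod
  exact h v q hsw hE hG hq hax haxq

end Summit.NavierStokesRegularity.NavierStokesRegularity.Cruxes.AxisymmetricKatoGlobal.StrategistS12g12

end
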